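import Mathlib
import Literature.NumberTheory.LFunctions.PrimesInResidueClassReciprocals
import HarnessLib

/-!
# Corrádi–Kátai (1969), Conjecture 1: the objects, the analytic input (proved), the sign-flip construction

Source: K. A. Corrádi and I. Kátai, *Some problems concerning the convolutions of number-theoretical functions*,
Arch. Math. (Basel) **20** (1969) 24–29, doi:10.1007/BF01898986 [CorradiKatai1969], p. 25: the class `M` of
multiplicative `±1`-valued functions, `h_f(n) = Σ_{ν=1}^{n−1} f(ν)f(n−ν)` ((1.1)), relation (1.2) `h_f(n) = o(n)`,
`C(f) = Σ_{p : f(p) = −1} 1/p`, "character-type" (periodic on the residues coprime to some `K ≥ 1`), and their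
**Conjecture 1** (p. 25, verbatim modulo notation): "If f ∈ M and f is not a 'character-type', then for the fulfilment
of (1.2) the condition C(f) = ∞ is a necessary and sufficient one."  CATEGORY: an explicitly labelled conjecture,
REFUTED (the sufficiency half fails) by an explicit family of counterexamples.  The analytic input is Dirichlet's
theorem in the form `Σ_{p ≡ a (k)} 1/p = ∞` for `(a,k) = 1` (H. L. Montgomery, R. C. Vaughan, *Multiplicative Number
Theory I*, CUP 2007 [MontgomeryVaughan2007], Cor. 4.12(c), p. 103), which is the tree theorem
`Literature.NumberTheory.LFunctions.not_summable_one_div_on_primes_in_residueClass` — so everything here is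
unconditional (standard axioms).

Counterexample (2001 H21 programme, Theorem 1.1 = `theoremCE`): for any infinite set `R` of odd primes with
`Σ_{p∈R} 1/p ≤ 1/8` (finitary form: every finite subsum `≤ 1/8`; one is constructed, `exists_admissible_R`: the least
primes above `16^{j+1}`), the completely multiplicative `f = fCE R` with `f(2) = 1`, `f(p) = χ₄(p)` (`p ∉ R`),
`f(p) = −χ₄(p)` (`p ∈ R`) has `C(f) = ∞`, is not of character-type, and `h_f(2^s) ≤ −2^{s−1} + 3` for all `s ≥ 2`
(unperturbed: `h_{f₀}(2^s) = −2^s + 3`, Lemma 2.1 `hCK_f0_two_pow`; thin-flip comparison `hCK_fCE_two_pow_le`), so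
`h_f(n) ≠ o(n)`: sufficiency fails, **`ckStatementOne_false : ¬ CKStatementOne`**.

This module (2001 file, first part): `hCK`, `IsMultPM`, `IsCompletelyMultPM`, `IsCharacterTypeMod`, `IsCharacterType`,
`CInfinite` (`C(f) = ∞` as non-summability of the indicator of `{p prime : f p = −1}` against `1/n`), `IsLittleO`;
the interface Prop `DirichletReciprocalDivergence` and its proof `dirichletReciprocalDivergence`; summability
helpers; the construction `f0 n = χ₄(odd part of n)`, `OmegaR R n = #` prime factors of `n` in `R` (with
multiplicity), `fCE R = f0 · (−1)^{Ω_R}`, basic facts and uniqueness `eq_fCE_of_prime_values`.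

Modules: `Literature.NumberTheory.Multiplicative.CorradiKatai1969.Defs` (objects, the interface Prop and its proof, the construction `f₀`, `Ω_R`, `fCE` and basic
facts), `.ThinFlip` (Lemma 2.1 and the thin-flip comparison: `h_f(2^s) ≤ −2^{s−1} + 3`), `.Density` (`C(f) = ∞`, not
character-type, `h_f ≠ o(n)`, `theoremCE`), `.Refutation` (an admissible `R` exists, `CKStatementOne`,
`ckStatementOne_false`, smoke tests).

Provenance: refutations bundle `papers/_cross/refutations` (H21 seat pub-refute-2, 2026-08-18), package modules
`Refutations.Vendor2001.CorradiKatai` (the 2001 H21 programme's kernel-checked file, archive route `summits/gb/free/y10`,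
refereed note Theorem 1.1, "upheld 2026-08-07"; namespace `CorradiKatai` there) and `Refutations.CorradiKatai1969`
(the unconditional wrapper), moved into the tree under the Lean-in-tree rule (human 2026-08-18).  Renamed:
`CKConjectureOne ↦ CKStatementOne`, `ckConjectureOne_false (hdir) ↦ ckStatementOne_false_of`, and the unconditional
`corradiKataiConjecture1_false ↦ ckStatementOne_false`; the 2001 interface Prop `DirichletReciprocalDivergence` is kept
and PROVED (`dirichletReciprocalDivergence`, module `Defs`).
-/

open Finset

namespace Literature.NumberTheory.Multiplicative.CorradiKatai1969

noncomputable section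
open scoped Classical

/-! ### The Corrádi–Kátai objects -/

/-- The additive self-convolution `h_f(n) = ∑_{ν=1}^{n-1} f(ν) f(n-ν)` (paper (1.1)). [cite: CorradiKatai1969, p. 25 (1.1)] -/
def hCK (f : ℕ → ℤ) (n : ℕ) : ℤ := ∑ ν ∈ Finset.Ico 1 n, f ν * f (n - ν)

/-- CK's class `M`: multiplicative and `±1`-valued on `ℕ≥1` (`f 0` is irrelevant). [cite: CorradiKatai1969, p. 25] -/
structure IsMultPM (f : ℕ → ℤ) : Prop where
  map_one : f 1 = 1
  pm : ∀ n, 1 ≤ n → f n = 1 ∨ f n = -1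
  map_mul_coprime : ∀ m n, 1 ≤ m → 1 ≤ n → Nat.Coprime m n → f (m * n) = f m * f n

/-- CK's class `M*`: completely multiplicative and `±1`-valued on `ℕ≥1`. [folklore] -/
structure IsCompletelyMultPM (f : ℕ → ℤ) : Prop where
  map_one : f 1 = 1
  pm : ∀ n, 1 ≤ n → f n = 1 ∨ f n = -1
  map_mul : ∀ m n, 1 ≤ m → 1 ≤ n → f (m * n) = f m * f n

/-- Auxiliary lemma: `{f : ℕ → ℤ} (h : IsCompletelyMultPM f) : IsMultPM f`. [folklore] -/
theorem IsCompletelyMultPM.isMultPM {f : ℕ → ℤ} (h : IsCompletelyMultPM f) : IsMultPM f :=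
  ⟨h.map_one, h.pm, fun m n hm hn _ => h.map_mul m n hm hn⟩

/-- `f` is of character-type with modulus `K` (CK p. 25, paper §1.1): `f m = f n`
whenever `m ≡ n (mod K)` and `(n, K) = 1`. [cite: CorradiKatai1969, p. 25] -/
def IsCharacterTypeMod (f : ℕ → ℤ) (K : ℕ) : Prop :=
  ∀ m n, 1 ≤ m → 1 ≤ n → m % K = n % K → Nat.Coprime n K → f m = f n

/-- `f` is of character-type: some modulus `K ≥ 1` works. [cite: CorradiKatai1969, p. 25] -/
def IsCharacterType (f : ℕ → ℤ) : Prop := ∃ K, 1 ≤ K ∧ IsCharacterTypeMod f K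

/-- `C(f) = ∑_{p ∈ P_f} 1/p = ∞` with `P_f = {p prime : f p = −1}`: divergence of this
series of nonnegative terms, stated as non-summability of the indicator series. [cite: CorradiKatai1969, p. 25] -/
def CInfinite (f : ℕ → ℤ) : Prop :=
  ¬ Summable (Set.indicator {p : ℕ | p.Prime ∧ f p = -1} fun n => (1 : ℝ) / n)

/-- `h n = o(n)` as `n → ∞` (relation (1.2) of the paper and of CK). [cite: CorradiKatai1969, p. 25 (1.2)] -/
def IsLittleO (h : ℕ → ℤ) : Prop :=
  ∀ ε : ℝ, 0 < ε → ∃ N : ℕ, ∀ n, N ≤ n → |(h n : ℝ)| ≤ ε * n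

/-! ### The analytic interface -/

/-- INTERFACE PROP of the 2001 file — the single analytic input, cited as "(Dirichlet)" in the proof of Theorem 1.1:
for every modulus `k ≥ 1` and every `a` coprime to `k`, the sum of the reciprocals of the primes `p ≡ a (mod k)`
diverges (Dirichlet 1837; Montgomery–Vaughan, *Multiplicative Number Theory I*, Cor. 4.12(c)).  PROVED right below
(`dirichletReciprocalDivergence`) from the tree theorem
`Literature.NumberTheory.LFunctions.not_summable_one_div_on_primes_in_residueClass`; the downstream theorems keep the
2001 shape `(hdir : DirichletReciprocalDivergence) → …` and are discharged in `Refutation`. [cite: MontgomeryVaughan2007, Cor. 4.12(c) p. 103] -/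
def DirichletReciprocalDivergence : Prop :=
  ∀ k a : ℕ, 0 < k → Nat.Coprime a k →
    ¬ Summable (Set.indicator {p : ℕ | p.Prime ∧ p % k = a % k} fun n => (1 : ℝ) / n)

/-- Dirichlet's reciprocal-divergence theorem: the interface Prop HOLDS (tree theorem
`Literature.NumberTheory.LFunctions.not_summable_one_div_on_primes_in_residueClass`, from Mathlib's
`ArithmeticFunction.vonMangoldt.LSeries_residueClass_lower_bound`). [cite: MontgomeryVaughan2007, Cor. 4.12(c) p. 103] -/
theorem dirichletReciprocalDivergence : DirichletReciprocalDivergence :=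
  fun k a hk hak => Literature.NumberTheory.LFunctions.not_summable_one_div_on_primes_in_residueClass k a hk hak

/-! ### Summability helpers -/

/-- Auxiliary lemma: `(S : Set ℕ) (n : ℕ) : 0 ≤ Set.indicator S (fun m => (1 : ℝ) / m) n`. [folklore] -/
theorem indicator_one_div_nonneg (S : Set ℕ) (n : ℕ) :
    0 ≤ Set.indicator S (fun m => (1 : ℝ) / m) n :=
  Set.indicator_apply_nonneg fun _ => by positivity

/-- A set of naturals all of whose finite reciprocal subsums are `≤ c` has a summable
reciprocal series (this is the sense in which the hypothesis `∑_{p∈R} 1/p ≤ 1/8` of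
Theorem 1.1 is used). [folklore] -/
theorem summable_indicator_of_subsums_le {R : Set ℕ} {c : ℝ}
    (hR : ∀ F : Finset ℕ, (∀ p ∈ F, p ∈ R) → ∑ p ∈ F, (1 : ℝ) / p ≤ c) :
    Summable (Set.indicator R fun n => (1 : ℝ) / n) := by
  apply summable_of_sum_range_le (c := c) (fun n => indicator_one_div_nonneg R n)
  intro n
  have h1 : ∑ i ∈ Finset.range n, Set.indicator R (fun m => (1 : ℝ) / m) i
      = ∑ i ∈ (Finset.range n).filter (· ∈ R), (1 : ℝ) / i := by
    rw [Finset.sum_filter]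
    refine Finset.sum_congr rfl fun i _ => ?_
    by_cases hi : i ∈ R
    · rw [Set.indicator_of_mem hi, if_pos hi]
    · rw [Set.indicator_of_notMem hi, if_neg hi]
  rw [h1]
  exact hR _ fun p hp => (Finset.mem_filter.mp hp).2

/-! ### The construction: `f₀`, `Ω_R` and the sign flip `fCE` -/

/-- The Corrádi–Kátai example `f₀`: `χ₄` of the odd part.  This is the completely
multiplicative `f₀` with `f₀(2) = 1` and `f₀(p) = χ₄(p)` for odd primes `p`
(CK p. 25, paper Lemma 2.1). [folklore] -/
def f0 (n : ℕ) : ℤ := ZMod.χ₄ ((ordCompl[2] n : ℕ) : ZMod 4)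

/-- `Ω_R(n)`: the number of prime factors of `n` lying in `R`, with multiplicity. [folklore] -/
def OmegaR (R : Set ℕ) (n : ℕ) : ℕ :=
  n.factorization.sum fun p k => if p ∈ R then k else 0

/-- The counterexample of Theorem 1.1: `f = f₀ · (−1)^{Ω_R}`, i.e. `χ₄` with the sign
flipped on the primes of `R` (see `eq_fCE_of_prime_values` for the identification with
"the `f ∈ M*` defined by `f(2) = 1`, `f(p) = χ₄(p)` for odd `p ∉ R`, `f(p) = −χ₄(p)`
for `p ∈ R`"). [folklore] -/
def fCE (R : Set ℕ) (n : ℕ) : ℤ := f0 n * (-1) ^ OmegaR R n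

/-! #### Basic facts about `f₀` -/

/-- Auxiliary lemma: `{n : ℕ} (hn : n ≠ 0) : ordCompl[2] n % 2 = 1`. [folklore] -/
theorem ordCompl2_odd {n : ℕ} (hn : n ≠ 0) : ordCompl[2] n % 2 = 1 := by
  have h := Nat.not_dvd_ordCompl Nat.prime_two hn
  omega

/-- Auxiliary lemma: `{l m : ℕ} (hm : m % 2 = 1) : ordCompl[2] (2 ^ l * m) = m`. [folklore] -/
theorem ordCompl2_two_pow_mul {l m : ℕ} (hm : m % 2 = 1) : ordCompl[2] (2 ^ l * m) = m := by
  have hm0 : m ≠ 0 := by omega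
  have h2m : ¬ (2 ∣ m) := by omega
  have hppos : 0 < (2 : ℕ) ^ l := pow_pos (by norm_num) l
  have hfac : (2 ^ l * m).factorization 2 = l := by
    rw [Nat.factorization_mul hppos.ne' hm0, Finsupp.add_apply,
      Nat.Prime.factorization_pow Nat.prime_two, Finsupp.single_eq_same,
      Nat.factorization_eq_zero_of_not_dvd h2m, add_zero]
  show (2 ^ l * m) / 2 ^ ((2 ^ l * m).factorization 2) = m
  rw [hfac, Nat.mul_div_cancel_left m hppos]

/-- Auxiliary lemma: `{l m : ℕ} (hm : m % 2 = 1) : f0 (2 ^ l * m) = ZMod.χ₄ ((m : ℕ) : ZMod 4)`. [folklore] -/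
theorem f0_two_pow_mul {l m : ℕ} (hm : m % 2 = 1) :
    f0 (2 ^ l * m) = ZMod.χ₄ ((m : ℕ) : ZMod 4) := by
  unfold f0
  rw [ordCompl2_two_pow_mul hm]

/-- Auxiliary lemma: `{n : ℕ} (hn : n % 2 = 1) : f0 n = ZMod.χ₄ ((n : ℕ) : ZMod 4)`. [folklore] -/
theorem f0_odd {n : ℕ} (hn : n % 2 = 1) : f0 n = ZMod.χ₄ ((n : ℕ) : ZMod 4) := by
  have h := f0_two_pow_mul (l := 0) hn
  simpa using h

/-- Auxiliary lemma: `{n : ℕ} (hn : n % 2 = 1) : ZMod.χ₄ ((n : ℕ) : ZMod 4) = 1 ∨ ZMod.χ₄ ((n : ℕ) : ZMod 4) = -1`. [folklore] -/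
theorem chi4_odd_pm {n : ℕ} (hn : n % 2 = 1) :
    ZMod.χ₄ ((n : ℕ) : ZMod 4) = 1 ∨ ZMod.χ₄ ((n : ℕ) : ZMod 4) = -1 := by
  rcases (by omega : n % 4 = 1 ∨ n % 4 = 3) with h | h
  · exact Or.inl (ZMod.χ₄_nat_one_mod_four h)
  · exact Or.inr (ZMod.χ₄_nat_three_mod_four h)

/-- Auxiliary lemma: `{n : ℕ} (hn : 1 ≤ n) : f0 n = 1 ∨ f0 n = -1`. [folklore] -/
theorem f0_pm {n : ℕ} (hn : 1 ≤ n) : f0 n = 1 ∨ f0 n = -1 := by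
  unfold f0
  exact chi4_odd_pm (ordCompl2_odd (by omega))

/-- Auxiliary lemma: `: f0 1 = 1`. [folklore] -/
theorem f0_one : f0 1 = 1 := by
  rw [f0_odd (by norm_num)]
  exact ZMod.χ₄_nat_one_mod_four (by norm_num)

/-- Auxiliary lemma: `: f0 2 = 1`. [folklore] -/
theorem f0_two : f0 2 = 1 := by
  have h : (2 : ℕ) = 2 ^ 1 * 1 := by norm_num
  rw [h, f0_two_pow_mul (by norm_num)]
  exact ZMod.χ₄_nat_one_mod_four (by norm_num)

/-- Auxiliary lemma: `{m n : ℕ} : f0 (m * n) = f0 m * f0 n`. [folklore] -/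
theorem f0_mul {m n : ℕ} : f0 (m * n) = f0 m * f0 n := by
  unfold f0
  rw [Nat.ordCompl_mul, Nat.cast_mul, map_mul]

/-! #### Basic facts about `Ω_R` -/

/-- Auxiliary lemma: `(R : Set ℕ) : OmegaR R 1 = 0`. [folklore] -/
theorem OmegaR_one (R : Set ℕ) : OmegaR R 1 = 0 := by
  unfold OmegaR
  simp

/-- Auxiliary lemma: `(R : Set ℕ) {m n : ℕ} (hm : m ≠ 0) (hn : n ≠ 0) : OmegaR R (m * n) = OmegaR R m + OmegaR R n`. [folklore] -/
theorem OmegaR_mul (R : Set ℕ) {m n : ℕ} (hm : m ≠ 0) (hn : n ≠ 0) :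
    OmegaR R (m * n) = OmegaR R m + OmegaR R n := by
  unfold OmegaR
  rw [Nat.factorization_mul hm hn]
  exact Finsupp.sum_add_index' (fun p => by simp) (fun p k₁ k₂ => by
    by_cases hp : p ∈ R <;> simp [hp])

/-- Auxiliary lemma: `(R : Set ℕ) {p : ℕ} (hp : p.Prime) : OmegaR R p = if p ∈ R then 1 else 0`. [folklore] -/
theorem OmegaR_prime (R : Set ℕ) {p : ℕ} (hp : p.Prime) :
    OmegaR R p = if p ∈ R then 1 else 0 := by
  unfold OmegaR
  rw [hp.factorization, Finsupp.sum_single_index (by simp)]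

/-- Auxiliary lemma: `(R : Set ℕ) {n : ℕ} (h : ∀ p ∈ R, ¬ p ∣ n) : OmegaR R n = 0`. [folklore] -/
theorem OmegaR_eq_zero (R : Set ℕ) {n : ℕ} (h : ∀ p ∈ R, ¬ p ∣ n) : OmegaR R n = 0 := by
  unfold OmegaR Finsupp.sum
  apply Finset.sum_eq_zero
  intro p hp
  have hdvd : p ∣ n := by
    have hmem : p ∈ n.primeFactors := by
      rwa [← Nat.support_factorization]
    exact Nat.dvd_of_mem_primeFactors hmem
  have hpR : p ∉ R := fun hmem => h p hmem hdvd
  simp [hpR]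

/-! #### Basic facts about `fCE` -/

/-- Auxiliary lemma: `(R : Set ℕ) : fCE R 1 = 1`. [folklore] -/
theorem fCE_one (R : Set ℕ) : fCE R 1 = 1 := by
  unfold fCE
  rw [f0_one, OmegaR_one, pow_zero, mul_one]

/-- Auxiliary lemma: `(R : Set ℕ) {m n : ℕ} (hm : 1 ≤ m) (hn : 1 ≤ n) : fCE R (m * n) = fCE R m * fCE R n`. [folklore] -/
theorem fCE_mul (R : Set ℕ) {m n : ℕ} (hm : 1 ≤ m) (hn : 1 ≤ n) :
    fCE R (m * n) = fCE R m * fCE R n := by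
  unfold fCE
  rw [f0_mul, OmegaR_mul R (by omega) (by omega), pow_add]
  ring

/-- Auxiliary lemma: `(R : Set ℕ) {n : ℕ} (hn : 1 ≤ n) : fCE R n = 1 ∨ fCE R n = -1`. [folklore] -/
theorem fCE_pm (R : Set ℕ) {n : ℕ} (hn : 1 ≤ n) : fCE R n = 1 ∨ fCE R n = -1 := by
  unfold fCE
  rcases f0_pm hn with h | h <;> rcases Nat.even_or_odd (OmegaR R n) with hk | hk
  · exact Or.inl (by rw [h, hk.neg_one_pow, one_mul])
  · exact Or.inr (by rw [h, hk.neg_one_pow, one_mul])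
  · exact Or.inr (by rw [h, hk.neg_one_pow]; norm_num)
  · exact Or.inl (by rw [h, hk.neg_one_pow]; norm_num)

/-- Auxiliary lemma: `(R : Set ℕ) : IsCompletelyMultPM (fCE R)`. [folklore] -/
theorem isCompletelyMultPM_fCE (R : Set ℕ) : IsCompletelyMultPM (fCE R) :=
  ⟨fCE_one R, fun _ hn => fCE_pm R hn, fun _ _ hm hn => fCE_mul R hm hn⟩

/-- Auxiliary lemma: `(R : Set ℕ) (h2 : 2 ∉ R) : fCE R 2 = 1`. [folklore] -/
theorem fCE_two (R : Set ℕ) (h2 : 2 ∉ R) : fCE R 2 = 1 := by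
  unfold fCE
  rw [f0_two, OmegaR_prime R Nat.prime_two, if_neg h2, pow_zero, mul_one]

/-- Auxiliary lemma: `(R : Set ℕ) {p : ℕ} (hp : p.Prime) (hodd : p % 2 = 1) (hpR : p ∉ R) : fCE R p = ZMod.χ₄ ((p : ℕ) : ZMod 4)`. [folklore] -/
theorem fCE_prime_of_notMem (R : Set ℕ) {p : ℕ} (hp : p.Prime) (hodd : p % 2 = 1)
    (hpR : p ∉ R) : fCE R p = ZMod.χ₄ ((p : ℕ) : ZMod 4) := by
  unfold fCE
  rw [f0_odd hodd, OmegaR_prime R hp, if_neg hpR, pow_zero, mul_one]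

/-- Auxiliary lemma: `(R : Set ℕ) {p : ℕ} (hp : p.Prime) (hodd : p % 2 = 1) (hpR : p ∈ R) : fCE R p = - ZMod.χ₄ ((p : ℕ) : ZMod 4)`. [folklore] -/
theorem fCE_prime_of_mem (R : Set ℕ) {p : ℕ} (hp : p.Prime) (hodd : p % 2 = 1)
    (hpR : p ∈ R) : fCE R p = - ZMod.χ₄ ((p : ℕ) : ZMod 4) := by
  unfold fCE
  rw [f0_odd hodd, OmegaR_prime R hp, if_pos hpR, pow_one]
  ring

/-- Auxiliary lemma: `(R : Set ℕ) {n : ℕ} (h : ∀ p ∈ R, ¬ p ∣ n) : fCE R n = f0 n`. [folklore] -/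
theorem fCE_eq_f0_of_no_factor_in (R : Set ℕ) {n : ℕ} (h : ∀ p ∈ R, ¬ p ∣ n) :
    fCE R n = f0 n := by
  unfold fCE
  rw [OmegaR_eq_zero R h, pow_zero, mul_one]

/-- Complete multiplicativity plus the prime values determine `f` on `ℕ≥1`; hence
`fCE R` is THE function `f ∈ M*` of Theorem 1.1 (statement-fidelity anchor). [folklore] -/
theorem eq_fCE_of_prime_values (R : Set ℕ) {g : ℕ → ℤ} (hg : IsCompletelyMultPM g)
    (hprime : ∀ p : ℕ, p.Prime → g p = fCE R p) : ∀ n, 1 ≤ n → g n = fCE R n := by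
  intro n
  induction n using Nat.strong_induction_on with
  | _ n ih =>
    intro hn
    rcases eq_or_lt_of_le hn with h1 | h1
    · rw [← h1, hg.map_one, fCE_one]
    · have hn2 : 2 ≤ n := h1
      have hpp : n.minFac.Prime := Nat.minFac_prime (by omega)
      obtain ⟨m, hm⟩ := n.minFac_dvd
      have hm1 : 1 ≤ m := by
        rcases Nat.eq_zero_or_pos m with h | h
        · subst h; omega
        · exact h
      have hmlt : m < n := by
        rw [hm]
        calc m = 1 * m := (one_mul m).symm
        _ < n.minFac * m := by
            exact Nat.mul_lt_mul_of_lt_of_le hpp.one_lt le_rfl (by omega)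
        _ = n.minFac * m := rfl
      have hp1 : 1 ≤ n.minFac := hpp.one_lt.le
      rw [hm, hg.map_mul _ _ hp1 hm1, (isCompletelyMultPM_fCE R).map_mul _ _ hp1 hm1,
        hprime _ hpp, ih m hmlt hm1]

end

end Literature.NumberTheory.Multiplicative.CorradiKatai1969

/-! ## `_holds` aliases (appended 2026-08-28)

The named fact(s) below are already theorems of the tree under another name; the `_holds`
alias records the discharge under the tree's naming convention (D-0026 bookkeeping: proof term =
the existing theorem, no statement or definition edited). -/

/-- `DirichletReciprocalDivergence` is a theorem of the tree (`Literature.NumberTheory.Multiplicative.CorradiKatai1969.dirichletReciprocalDivergence`). [cite: MontgomeryVaughan2007, Cor. 4.12(c) p. 103] -/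
theorem _root_.Literature.NumberTheory.Multiplicative.CorradiKatai1969.DirichletReciprocalDivergence_holds : _root_.Literature.NumberTheory.Multiplicative.CorradiKatai1969.DirichletReciprocalDivergence :=
  _root_.Literature.NumberTheory.Multiplicative.CorradiKatai1969.dirichletReciprocalDivergence
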